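import Summits.QuantumFields.YangMills.Theses.BalabanLadder
import Summits.QuantumFields.YangMills.Theses.BalabanFamilyExport
import Summits.QuantumFields.YangMills.Theses.BalabanFluctuationExport
import HarnessLib

/-!
# Line `fluctuation_export` — condition on Bałaban's block averages (D-0145 ideator ym-idea-9 g2, LINE 4, lens «complete»)

Skeleton for the crux `Summit.QuantumFields.YangMills.Theses.BalabanLadder.UVSeamRec` (stmt-QuantumFields-20043), realised as the
route `route-QuantumFields-BalabanFluctuationExport`: the five registered stubs are that route's items BY NAME
(`CondResponse`, `CondDecoupling`, `FluctuationExportGlue`, `FamilySeam`, `FloorsEngine`), and `UVSeamRec_of` concludes the crux by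
name through `BalabanFamilyExport.closes` (the glue turns conditional response + conditional decoupling into `FamilyCeilings`).
No summit, leg or spine crux is proved here; sorries live only inside `stub_*`.
-/

set_option autoImplicit false

namespace Summit.QuantumFields.YangMills.Cruxes.UVSeamRec.FluctuationExport

open Summit.QuantumFields.YangMills.Theses.BalabanFluctuationExport

/-- stub (route item, crux rank 3): one-point conditional response to the block field, sup form. -/
theorem stub_condResponse : CondResponse := by
  sorry

/-- stub (route item, crux rank 2, hardest): conditionally-centred separated products are `(C/b⁴)ⁿ`-small given the block field (tilt form). -/
theorem stub_condDecoupling : CondDecoupling := by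
  sorry

/-- stub (route item, support): the finite subset expansion `CondResponse → CondDecoupling → FamilyCeilings` (provable now). -/
theorem stub_fluctuationExportGlue : FluctuationExportGlue := by
  sorry

/-- stub (route item, crux rank 4; shared verbatim with BalabanFamilyExport item 25033): the volume seam. -/
theorem stub_familySeam : FamilySeam := by
  sorry

/-- stub (route item, crux rank 5; shared v5(α) engine, item 25034): the floors engine. -/
theorem stub_floorsEngine : FloorsEngine := by
  sorry

/-- The composition: the five stubs give the spine crux BY NAME (kernel-checked, no sorry outside the stubs). -/
theorem UVSeamRec_of :
    CondResponse → CondDecoupling → FluctuationExportGlue → FamilySeam → FloorsEngine →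
      Summit.QuantumFields.YangMills.Theses.BalabanLadder.UVSeamRec :=
  fun h₁ h₂ h₃ h₄ h₅ => Summit.QuantumFields.YangMills.Theses.BalabanFluctuationExport.closes h₁ h₂ h₃ h₄ h₅

/-- … hence, from the stubs, the crux (closed modulo the five sorries above). -/
theorem UVSeamRec_holds_of_stubs : Summit.QuantumFields.YangMills.Theses.BalabanLadder.UVSeamRec :=
  UVSeamRec_of stub_condResponse stub_condDecoupling stub_fluctuationExportGlue stub_familySeam stub_floorsEngine

end Summit.QuantumFields.YangMills.Cruxes.UVSeamRec.FluctuationExport
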